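import Summits.Ventures.PercRepro.TheoremOAll
import Summits.Ventures.PercRepro.PerFlatTransfer

/-!
# PercRepro — the `(6, 3)` frame: C-025 at `(6, 3)` on every matroid, modulo its simple coloop-free core (p2, gen 6)

`proofs/MINE2-RLS.md` §18 leaves C-025 at `(6, 3)` open exactly at its simple coloop-free core (the per-plane
inequality of a soft max-trace rule).  This file does for `(6, 3)` what `TheoremOAll.lean` does for `(5, 3)`, with
that core as a HYPOTHESIS, so that a paper proof of the core plugs in as one lemma:
* a LOOP halves both counts (p3's halving lemmas);
* a PARALLEL PAIR is Theorem F (p3's `c025_step_of_delete_contract`) with the induction hypothesis at `(6, 3)` on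
  `M ＼ {e}` and Theorem N at `(5, 2)` on `M ／ {e}` (`c025_two_all`, `Φ(5, 2) = 10/3 ≥ 3`);
* a COLOOP at `ρ(E) = 6`: `#U_M(6, 3) = #U_{M′}(5, 3)` and `#Y_M(6, 3) = W₅(M′) + 2·W₄(M′) + W₃(M′)
  ≥ (1 + 2·(5/4) + 1)·#U_{M′}(5, 3)` by the two injections and Theorem O on `M′` (`c025_five_three_all`);
* `ρ(E) < 6` makes `U(6, 3)` empty; otherwise `M` is simple with `ρ(E) ≥ 6`, coloop-free when `ρ(E) = 6`: the core.

**`c025_six_three_of_core`**: the core on every simple matroid of rank `≥ 6` (coloop-free at rank `6`) gives C-025 at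
`(6, 3)` on EVERY finite matroid.  **`c025_six_three_of_perPlane`**: the same from a per-plane certificate — for any
nonnegative rule `f` (which may depend on the matroid, e.g. through ranks), the per-plane inequality `3 · #U_G ≤ Σ_{S ∈ Y} f G S / Σ_{G′} f G′ S` on every plane `G` of every
such core matroid suffices (`PerFlatTransfer.c025_of_perFlat_normalized` + `flatsQ_three`).  The open piece of
`MINE2-RLS.md` §18 is therefore exactly the hypothesis `hflat` of the second theorem.
-/

open scoped Matroid

namespace PercRepro

namespace SixThree

open Finset Set ThmN

variable {α : Type}

/-- `Φ(6, 3) = 3`. -/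
theorem phiK_six_three' : phiK 6 3 = 3 := by
  unfold phiK
  rw [show Finset.Ioo 3 6 = {4, 5} from by decide, Finset.sum_pair (by decide),
    show Nat.choose 9 4 = 126 by decide, show Nat.choose 9 5 = 126 by decide, show Nat.choose 9 6 = 84 by decide]
  norm_num

/-- The loop step at `(6, 3)` (p3's halving lemmas). -/
theorem RLS_six_three_of_loop (M : Matroid α) [M.Finite] {e : α} (he : M.IsLoop e)
    (h : RLS (M ＼ {e}) 6 3) : RLS M 6 3 := by
  unfold RLS at h ⊢
  have he' : e ∈ M.loops := he
  rw [ncard_U_eq_two_mul_of_loop he' 6 3, ncard_Y_eq_two_mul_of_loop he' 6 3]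
  push_cast at h ⊢
  linarith

/-- The coloop step at `(6, 3)`: `#Y_M = W₅(M′) + 2·W₄(M′) + W₃(M′) ≥ (2 + 2·(5/4))·#U_{M′}(5, 3) = (9/2)·#U_M ≥ 3·#U_M`,
using Theorem O on `M′ = M ＼ {e}`. -/
theorem RLS_six_three_of_coloop (M : Matroid α) [M.Finite] {e : α} (he : M.IsColoop e)
    (hR : M.eRank = (6 : ℕ)) : RLS M 6 3 := by
  classical
  have hU : Matroid.topCount M (5 + 1) (2 + 1) = Matroid.topCount (M.delete {e}) 5 (2 + 1) :=
    Matroid.topCount_eq_of_isColoop_of_eRank he 2 hR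
  have hY : Matroid.midCount M (5 + 1) 3 = Matroid.levelCount M 4 + Matroid.levelCount M 5 := by
    rw [Matroid.midCount_eq_sum (5 + 1) 3 (by omega), show Finset.Ioo 3 (5 + 1) = {4, 5} from by decide,
      Finset.sum_pair (by decide)]
  have hlev4 : Matroid.levelCount M (3 + 1) = Matroid.levelCount (M ＼ {e}) (3 + 1) +
      Matroid.levelCount (M ＼ {e}) 3 := Matroid.levelCount_succ_eq_of_isColoop he 3
  have hlev5 : Matroid.levelCount M (4 + 1) = Matroid.levelCount (M ＼ {e}) (4 + 1) +
      Matroid.levelCount (M ＼ {e}) 4 := Matroid.levelCount_succ_eq_of_isColoop he 4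
  have htop : Matroid.topCount (M.delete {e}) 5 3 ≤ Matroid.levelCount (M.delete {e}) 5 :=
    Matroid.topCount_le_levelCount_top 5 3
  have hbot : Matroid.topCount (M.delete {e}) 5 3 ≤ Matroid.levelCount (M.delete {e}) 3 :=
    Matroid.topCount_le_levelCount_bot 5 3
  -- Theorem O on `M ＼ {e}`: `(5/4)·#U_{M′}(5, 3) ≤ #Y_{M′}(5, 3) = W₄(M′)`
  have hO : phiK 5 3 * (Matroid.topCount (M.delete {e}) 5 3 : ℚ) ≤ (Matroid.midCount (M.delete {e}) 5 3 : ℚ) :=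
    ThmO.c025_five_three_all (M ＼ {e})
  have hY' : Matroid.midCount (M.delete {e}) 5 3 = Matroid.levelCount (M.delete {e}) 4 := by
    rw [Matroid.midCount_eq_sum 5 3 (by omega), show Finset.Ioo 3 5 = {4} from by decide,
      Finset.sum_singleton]
  rw [ThmO.phiK_five_three, hY'] at hO
  -- translate to the C025 body
  show phiK 6 3 * (Matroid.topCount M 6 3 : ℚ) ≤ (Matroid.midCount M 6 3 : ℚ)
  rw [phiK_six_three']
  have hU' : Matroid.topCount M 6 3 = Matroid.topCount (M.delete {e}) 5 3 := hU
  have hY6 : Matroid.midCount M 6 3 = Matroid.levelCount M 4 + Matroid.levelCount M 5 := hY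
  have hlev4' : Matroid.levelCount M 4 = Matroid.levelCount (M.delete {e}) 4 +
      Matroid.levelCount (M.delete {e}) 3 := hlev4
  have hlev5' : Matroid.levelCount M 5 = Matroid.levelCount (M.delete {e}) 5 +
      Matroid.levelCount (M.delete {e}) 4 := hlev5
  have hYM : Matroid.midCount M 6 3 = Matroid.levelCount (M.delete {e}) 5 + 2 * Matroid.levelCount (M.delete {e}) 4 +
      Matroid.levelCount (M.delete {e}) 3 := by
    rw [hY6, hlev4', hlev5']
    ring
  rw [hU', hYM]
  push_cast
  have h1 : (Matroid.topCount (M.delete {e}) 5 3 : ℚ) ≤ Matroid.levelCount (M.delete {e}) 5 := by exact_mod_cast htop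
  have h2 : (Matroid.topCount (M.delete {e}) 5 3 : ℚ) ≤ Matroid.levelCount (M.delete {e}) 3 := by exact_mod_cast hbot
  have h0 : (0 : ℚ) ≤ Matroid.topCount (M.delete {e}) 5 3 := by positivity
  linarith

/-- Theorem F's step at `(6, 3)`: a parallel pair reduces `RLS M 6 3` to `RLS (M ＼ {e}) 6 3` and `(5, 2)` on
`M ／ {e}`, which is Theorem N. -/
theorem RLS_six_three_of_parallel (M : Matroid α) [M.Finite] {e e' : α} (he : M.Indep {e})
    (he' : e' ∈ M.E) (hne : e' ≠ e) (hpar : e ∈ M.closure {e'}) (h1 : RLS (M ＼ {e}) 6 3) : RLS M 6 3 := by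
  have key := c025_step_of_delete_contract he (spans_of_parallel he' hne hpar) 5 2
  have h2 : RLS (M ／ {e}) 5 2 := c025_two_all (M ／ {e}) 5 (by norm_num)
  unfold RLS at h1 h2 ⊢
  simp only [show (5 + 1 : ℕ) = 6 from rfl, show (2 + 1 : ℕ) = 3 from rfl] at key
  exact key h1 h2

/-- **C-025 at `(6, 3)` on every finite matroid, modulo its simple coloop-free core** (the `|E|`-induction of
`MINE2-RLS.md` §14/§16 Step 0 at `(6, 3)`): if every simple matroid of rank `≥ 6` that is coloop-free when its rank is
`6` satisfies `RLS · 6 3`, then every finite matroid does — loops halve, parallel pairs by Theorem F + Theorem N at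
`(5, 2)`, a coloop at `ρ(E) = 6` by the coloop step with Theorem O, `ρ(E) < 6` trivially. -/
theorem rls_six_three_of_core
    (hcore : ∀ (M : Matroid α) [M.Finite], ThmH.Simple M → (6 : ℕ∞) ≤ M.eRank →
      (M.eRank = 6 → ∀ e, ¬ M.IsColoop e) → RLS M 6 3)
    (M : Matroid α) [M.Finite] : RLS M 6 3 := by
  suffices H : ∀ n : ℕ, ∀ (M : Matroid α) [M.Finite], M.E.ncard = n → RLS M 6 3 from H _ M rfl
  intro n
  induction n using Nat.strong_induction_on with
  | _ n ih =>
  intro M _ hn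
  classical
  have hdel : ∀ e ∈ M.E, (M ＼ {e}).E.ncard < n := by
    intro e he
    rw [Matroid.delete_ground, ← hn, ← Set.ncard_sdiff_singleton_add_one he M.ground_finite]
    omega
  -- Case 1: a loop
  by_cases hL : ∃ e ∈ M.E, M.IsLoop e
  · obtain ⟨e, he, hloopE⟩ := hL
    exact RLS_six_three_of_loop M hloopE (ih _ (hdel e he) (M ＼ {e}) rfl)
  push Not at hL
  -- Case 2: a parallel pair
  by_cases hP : ∃ e ∈ M.E, ∃ e' ∈ M.E, e' ≠ e ∧ e ∈ M.closure {e'}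
  · obtain ⟨e, he, e', he', hne, hpar⟩ := hP
    have heI : M.Indep {e} := Matroid.indep_singleton.2 ((Matroid.not_isLoop_iff he).1 (hL e he))
    exact RLS_six_three_of_parallel M heI he' hne hpar (ih _ (hdel e he) (M ＼ {e}) rfl)
  push Not at hP
  -- Case 3: simple
  have hs : ThmH.Simple M :=
    fun e he f hf hef => eRk_pair_eq_two_of_simple M hL (fun e he e' he' hne => hP e he e' he' hne) he hf hef
  rcases lt_or_ge M.eRank (6 : ℕ∞) with hlt | hge
  · exact RLS_of_eRank_lt M (p := 6) (q := 3) (by exact_mod_cast hlt)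
  by_cases hC : M.eRank = 6 ∧ ∃ e, M.IsColoop e
  · obtain ⟨hR, e, hcol⟩ := hC
    exact RLS_six_three_of_coloop M hcol (by exact_mod_cast hR)
  · have hcolfree : M.eRank = 6 → ∀ e, ¬ M.IsColoop e := fun hR e hcol => hC ⟨hR, e, hcol⟩
    exact hcore M hs hge hcolfree

end SixThree

/-- **C-025 at `(6, 3)` for every finite matroid, modulo its core**: if
`3 · #{A ⊆ E : ρ(A) = 6, ρ(E ∖ A) = 3} ≤ #{A ⊆ E : 3 < ρ(A) < 6}` holds on every SIMPLE matroid of rank `≥ 6` that is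
coloop-free when its rank is `6`, it holds on every finite matroid (the `C025` body at `(6, 3)`). -/
theorem c025_six_three_of_core {α : Type}
    (hcore : ∀ (M : Matroid α) [M.Finite], ThmH.Simple M → (6 : ℕ∞) ≤ M.eRank →
      (M.eRank = 6 → ∀ e, ¬ M.IsColoop e) →
      phiK 6 3 * ({A : Set α | A ⊆ M.E ∧ M.eRk A = ((6 : ℕ) : ℕ∞) ∧ M.eRk (M.E \ A) = ((3 : ℕ) : ℕ∞)}.ncard : ℚ) ≤
        ({A : Set α | A ⊆ M.E ∧ ((3 : ℕ) : ℕ∞) < M.eRk A ∧ M.eRk A < ((6 : ℕ) : ℕ∞)}.ncard : ℚ))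
    (M : Matroid α) [M.Finite] :
    phiK 6 3 * ({A : Set α | A ⊆ M.E ∧ M.eRk A = ((6 : ℕ) : ℕ∞) ∧ M.eRk (M.E \ A) = ((3 : ℕ) : ℕ∞)}.ncard : ℚ) ≤
      ({A : Set α | A ⊆ M.E ∧ ((3 : ℕ) : ℕ∞) < M.eRk A ∧ M.eRk A < ((6 : ℕ) : ℕ∞)}.ncard : ℚ) := by
  have h := SixThree.rls_six_three_of_core (fun M _ hs hge hcol => hcore M hs hge hcol) M
  unfold ThmN.RLS at h
  exact h

/-- **C-025 at `(6, 3)` for every finite matroid from a per-plane certificate**: for any nonnegative rule `f` on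
(matroid, plane, set) triples, if on every simple matroid of rank `≥ 6` (coloop-free at rank `6`) every plane `G` satisfies
`3 · #{B ⊆ G : ρ(B) = 3, ρ(E ∖ B) = 6} ≤ Σ_{S : 3 < ρ(S) < 6} f G S / Σ_{G′ plane} f G′ S`, then
`3 · #U(6, 3) ≤ #Y(6, 3)` on every finite matroid.  The hypothesis `hflat` is exactly the open per-plane inequality of
`MINE2-RLS.md` §18 (soft max-trace `f G S = θ^{|S ∩ G| − 3}`, `θ ∈ [5, 6]`, or any rule that survives). -/
theorem c025_six_three_of_perPlane {α : Type} [DecidableEq α]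
    (f : (M : Matroid α) → [M.Finite] → Finset α → Finset α → ℚ)
    (hf : ∀ (M : Matroid α) [M.Finite] G S, 0 ≤ f M G S)
    (hflat : ∀ (M : Matroid α) [M.Finite], ThmH.Simple M → (6 : ℕ∞) ≤ M.eRank →
      (M.eRank = 6 → ∀ e, ¬ M.IsColoop e) → ∀ G ∈ ThmH.planes M,
      (3 : ℚ) * ((PerFlat.UqG M 6 3 G).card : ℚ) ≤
        ∑ S ∈ PerFlat.Yq M 6 3, f M G S / ∑ G' ∈ ThmH.planes M, f M G' S)
    (M : Matroid α) [M.Finite] :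
    phiK 6 3 * ({A : Set α | A ⊆ M.E ∧ M.eRk A = ((6 : ℕ) : ℕ∞) ∧ M.eRk (M.E \ A) = ((3 : ℕ) : ℕ∞)}.ncard : ℚ) ≤
      ({A : Set α | A ⊆ M.E ∧ ((3 : ℕ) : ℕ∞) < M.eRk A ∧ M.eRk A < ((6 : ℕ) : ℕ∞)}.ncard : ℚ) := by
  apply c025_six_three_of_core
  intro M _ hs hge hcol
  rw [SixThree.phiK_six_three']
  apply PerFlat.c025_of_perFlat_normalized M 6 3 (by norm_num) (f M) (hf M)
  intro G hG
  rw [PerFlat.flatsQ_three] at hG ⊢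
  exact hflat M hs hge hcol G hG

end PercRepro
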